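import Mathlib
import HarnessLib
import Literature.AlgebraicGeometry.HodgeTheory.SemiregularityHigherSigma
import Literature.AlgebraicGeometry.HodgeTheory.SemiregularityMapDinatural
import Literature.AlgebraicGeometry.Modules.ExtensionContraction
import Summits.HodgeConjecture.HodgeConjecture.Theorems.KleimanBFSeedsAtiyahClassStructureSheaf

/-!
# THEOREM Σ for the structure sheaf: classes `E → 𝒪_X → E[2]` of `Ext²(E, E)` are killed by every `σ_q`, `q ≥ 1`
# (route `KleimanBFSeeds`, crux K2ᵀ 28148 — a typed obstruction for the (C2)∕D7 design class)

HONEST FRAMING: HELPER ∕ obstruction lemmas `--supports stmt-HodgeConjecture-28148` (crux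
`TwistNormalisedKleimanSemiregularAnchor`, registered rung `stub_rung_CMclass_d3 : KleimanAnchorRungCM 3`). This is the
kernel-checked core of THEOREM Σ of the crux workfile
`Cruxes/TwistNormalisedKleimanSemiregularAnchor/SIGMA-INVISIBLE-N8-rung1-g2.md` in the case `F = 𝒪_X` (`a = 0`): for a finite
locally free `E` on an `S`-scheme, every class of `Ext²(E, E)` that FACTORS THROUGH THE STRUCTURE SHEAF —
`x = u · B` with `u : E → 𝒪_X`, `B ∈ Ext²(𝒪_X, E)`, or `x = B′ · u′` with `u′ : 𝒪_X → E`, `B′ ∈ Ext²(E, 𝒪_X)` — lies in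
`ker σ_q` for EVERY `q ≥ 1` (`sigmaHigher_mk₀_comp_eq_zero_of_unitModule`, `sigmaHigher_comp_mk₀_eq_zero_of_unitModule`);
hence an `I`-semiregular `E` with `1 ∉ I` (no trace component) has NO such non-zero class
(`IsISemiregular.mk₀_comp_eq_zero_of_unitModule`). On the real carriers: Mathlib `Ext` in `X.Modules` (universe `u+1`, the tree's instance
`hasExt_modules`, as in `SemiregularityMapDinatural`), the tree's `sigmaHigher` ∕ `IsISemiregular` (`HodgeTheory/SemiregularityHigherSigma`).

PROOF. (1) `atiyahClass_unitModule_eq_zero`: the Atiyah ∕ jet sequence `0 → 𝓗om(𝒪^∨, Ω¹) → P¹(𝒪) → 𝒪 → 0`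
(`HodgeTheory/AtiyahClass`) SPLITS — `s ↦ (s, δ(s, 1))` («`s ↦ (s, ds)`») is `𝒪`-linear for the twisted structure
`a·(s, φ) = (as, aφ + δ(a, s))` by Leibniz — so its class is `0` (Mathlib `ShortExact.comp_extClass`). (2) Hence the
first Atiyah STEP of `𝒪` dies after `ι : 𝒪 → 𝓗om(𝒪^∨, Ω⁰)` (tree `atiyahClass_comp_hodgeSheafOneIso_inv`:
`At · e₁⁻¹ = ι · at₀`), so `(z · ι) · At(𝒪)^q = 0` for `q ≥ 1` (`At^q = at₀ · …`) and `σ_q^{𝒪}(z) = Tr(0) = 0`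
(`sigmaHigher_unitModule_eq_zero`). (3) DINATURALITY of `σ_q` (tree `sigmaHigher_dinatural`, BF Cor. 4.8):
`σ_q^{E}(u · B) = σ_q^{𝒪}(B · u) = 0`. Nothing here constructs a sheaf or proves the rung, K2ᵀ, `WeilSixfolds`, HC_AV,
HC_CM or HC; the dimension-count APPLICATION to the «N′ = 8» design (≥ r₀(15r₀ − 210) blind classes ⇒ dead for
r₀ ≥ 15) stays pen-level in the workfile.

References: [Atiyah1957] §2 Thm. 2, §4, Prop. 9 (trivial bundle: `b = 0`); [BuchweitzFlenner2003] §3 (functoriality of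
`At`), Def. 4.1, Cor. 4.8; tree `SemiregularityHigherSigma`, `SemiregularityMapDinatural`, `AtiyahClass`.
-/

-- every declaration of this problem lives in `Summit.HodgeConjecture.HodgeConjecture.…` (summit = sub-problem)
set_option linter.dupNamespace false

noncomputable section

open CategoryTheory CategoryTheory.Abelian AlgebraicGeometry Opposite TopologicalSpace Limits

namespace Summit.HodgeConjecture.HodgeConjecture.Theorems

open Literature.AlgebraicGeometry.Modules Literature.AlgebraicGeometry.Motives
open Literature.AlgebraicGeometry.HodgeTheory

universe u

variable {S : Type u} [CommRing S] {X : Over (Spec (CommRingCat.of S))}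

/-! ### §1 `At(𝒪_X) = 0`: the jet sequence of the structure sheaf splits -/

/-- `δ(a, s) = s · δ(a, 1)` on the structure sheaf. [cite: Atiyah1957, §4 (p. 193)] -/
theorem deltaHom_unit_eq_smul (U : X.left.Opens) (a s : Γ(X.left, U)) :
    deltaHom (unitModule X.left) U a (show Γ(unitModule X.left, U) from s) =
      s • deltaHom (unitModule X.left) U a (show Γ(unitModule X.left, U) from (1 : Γ(X.left, U))) := by
  have h1 : (show Γ(unitModule X.left, U) from s) =
      s • (show Γ(unitModule X.left, U) from (1 : Γ(X.left, U))) := (mul_one s).symm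
  rw [← deltaHom_smul_right, ← h1]

/-- Leibniz for the connection term: `δ(as, 1) = a · δ(s, 1) + δ(a, s)` — the `𝒪(U)`-linearity of `s ↦ (s, ds)` for
the twisted module structure of `P¹(𝒪_X)`. [cite: Atiyah1957, §4 (p. 193)] -/
theorem deltaHom_unit_mul (U : X.left.Opens) (a s : Γ(X.left, U)) :
    deltaHom (unitModule X.left) U (a * s) (show Γ(unitModule X.left, U) from (1 : Γ(X.left, U))) =
      a • deltaHom (unitModule X.left) U s (show Γ(unitModule X.left, U) from (1 : Γ(X.left, U))) +
        deltaHom (unitModule X.left) U a (show Γ(unitModule X.left, U) from s) := by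
  rw [deltaHom_unit_eq_smul U a s, deltaHom_mul]

/-- **The Atiyah sequence of `𝒪_X` splits**: an `𝒪_X`-linear section `σ : 𝒪_X → P¹(𝒪_X)`, `s ↦ (s, ds) = (s, δ(s,1))`,
of `P¹(𝒪_X) → 𝒪_X` (`HodgeTheory/AtiyahClass` model) — `d` is a connection on the trivial line bundle.
[cite: Atiyah1957, §2 Thm. 2 and §4] -/
theorem exists_splitting_jetπ_unitModule :
    ∃ σ : unitModule X.left ⟶ jetModule (unitModule X.left), σ ≫ jetπ (unitModule X.left) = 𝟙 _ := by
  refine ⟨⟨PresheafOfModules.homMk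
      { app := fun U => AddCommGrpCat.ofHom
          { toFun := fun s : Γ(unitModule X.left, U.unop) =>
              (JetSections.mk s (deltaHom (unitModule X.left) U.unop (show Γ(X.left, U.unop) from s)
                (show Γ(unitModule X.left, U.unop) from (1 : Γ(X.left, U.unop)))) :
                JetSections (unitModule X.left) U.unop)
            map_zero' := Prod.ext rfl (deltaHom_zero_left (unitModule X.left) _)
            map_add' := fun s t => Prod.ext rfl (deltaHom_add_left (unitModule X.left) _ _ _) }
        naturality := fun {U V} i => by
          refine AddCommGrpCat.ext fun (s : Γ(unitModule X.left, U.unop)) => Prod.ext rfl ?_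
          change deltaHom (unitModule X.left) V.unop
              (show Γ(X.left, V.unop) from (unitModule X.left).presheaf.map i.unop.op s)
              (show Γ(unitModule X.left, V.unop) from (1 : Γ(X.left, V.unop))) =
            restrictHom i.unop (deltaHom (unitModule X.left) U.unop (show Γ(X.left, U.unop) from s)
              (show Γ(unitModule X.left, U.unop) from (1 : Γ(X.left, U.unop))))
          rw [restrictHom_deltaHom, unitModule_map_one]
          rfl }
      (fun U (a : Γ(X.left, U.unop)) (s : Γ(unitModule X.left, U.unop)) => Prod.ext rfl (by
        change deltaHom (unitModule X.left) U.unop (a * (show Γ(X.left, U.unop) from s))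
            (show Γ(unitModule X.left, U.unop) from (1 : Γ(X.left, U.unop))) =
          a • deltaHom (unitModule X.left) U.unop (show Γ(X.left, U.unop) from s)
            (show Γ(unitModule X.left, U.unop) from (1 : Γ(X.left, U.unop))) +
          deltaHom (unitModule X.left) U.unop a s
        exact deltaHom_unit_mul U.unop a _))⟩, ?_⟩
  exact Scheme.Modules.hom_ext _ _ fun U => AddCommGrpCat.ext fun (s : Γ(unitModule X.left, U)) => rfl

/-- **`At(𝒪_X) = 0`** (`HodgeTheory/AtiyahClass` model): the Atiyah class of the structure sheaf of any `S`-scheme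
vanishes — its jet sequence splits. [cite: Atiyah1957, §2 Thm. 2, Prop. 9] -/
theorem atiyahClass_unitModule_eq_zero : atiyahClass (unitModule X.left) = 0 := by
  obtain ⟨σ, hσ⟩ := exists_splitting_jetπ_unitModule (X := X)
  have hS := jetShortComplex_shortExact (unitModule X.left)
  have h1 : hS.extClass = (Ext.mk₀ (σ ≫ jetπ (unitModule X.left))).comp hS.extClass (zero_add 1) := by
    rw [hσ]
    exact (Ext.mk₀_id_comp hS.extClass).symm
  have h2 : (Ext.mk₀ (jetπ (unitModule X.left))).comp hS.extClass (zero_add 1) = 0 := hS.comp_extClass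
  change hS.extClass = 0
  rw [h1, ← Ext.mk₀_comp_mk₀_assoc, h2]
  exact Ext.comp_zero _ _ _ _ _

/-! ### §2 The Atiyah powers of `𝒪_X` die after `ι`, so `σ_q^{𝒪} = 0` for `q ≥ 1` -/

/-- `ι · at₀(𝒪) = At(𝒪) · e₁⁻¹ = 0` in `Ext¹(𝒪, 𝓗om(𝒪^∨, ⋀¹Ω¹))` (tree `atiyahClass_comp_hodgeSheafOneIso_inv`).
[cite: BuchweitzFlenner2003, §3] -/
theorem toTwistHodgeZero_comp_atiyahClassStep_unitModule :
    (Ext.mk₀ (toTwistHodgeZero (unitModule X.left))).comp (atiyahClassStep (unitModule X.left) 0)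
      (zero_add 1) = 0 := by
  rw [← atiyahClass_comp_hodgeSheafOneIso_inv (unitModule X.left), atiyahClass_unitModule_eq_zero]
  simp only [Ext.zero_comp]

/-- For `q ≥ 1` and any `z ∈ Ext²(F, 𝒪)`: `(z · ι) · At(𝒪)^q = 0` (`At^q = at₀ · at₁ ⋯`, and `ι · at₀ = 0`).
[cite: BuchweitzFlenner2003, §4 (At^k)] -/
theorem comp_toTwistHodgeZero_comp_atiyahClassPower_unitModule {F : X.left.Modules}
    (z : Ext F (unitModule X.left) 2) (q : ℕ) (hq : 1 ≤ q) :
    (z.comp (Ext.mk₀ (toTwistHodgeZero (unitModule X.left))) (add_zero 2)).comp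
      (atiyahClassPower (unitModule X.left) q) (add_comm 2 q) = 0 := by
  induction q with
  | zero => exact absurd hq (by norm_num)
  | succ q ih =>
    rcases Nat.eq_zero_or_pos q with hq0 | hqpos
    · subst hq0
      -- `At¹ = (𝟙) · at₀`
      rw [atiyahClassPower_succ (unitModule X.left), atiyahClassPower_zero (unitModule X.left), Ext.mk₀_id_comp]
      rw [Ext.comp_assoc_of_second_deg_zero, toTwistHodgeZero_comp_atiyahClassStep_unitModule]
      simp only [Ext.comp_zero]
    · rw [atiyahClassPower_succ (unitModule X.left), ← Ext.comp_assoc _ _ _ (add_comm 2 q) rfl (by lia), ih hqpos]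
      simp only [Ext.zero_comp]

/-- **`σ_q^{𝒪_X} = 0` for `q ≥ 1`**: every higher semiregularity component of the structure sheaf vanishes
(`σ_q(z) = Tr((z · ι) · At(𝒪)^q)` and the Atiyah powers of `𝒪` are zero after `ι`). [cite: BuchweitzFlenner2003, Def. 4.1] -/
theorem sigmaHigher_unitModule_eq_zero (h𝒪 : IsFiniteLocallyFree (unitModule X.left)) (q : ℕ) (hq : 1 ≤ q)
    (z : Ext (unitModule X.left) (unitModule X.left) 2) :
    sigmaHigher h𝒪 q z = 0 := by
  rw [sigmaHigher_apply, comp_toTwistHodgeZero_comp_atiyahClassPower_unitModule z q hq]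
  exact map_zero _

/-! ### §3 THEOREM Σ for `F = 𝒪_X`: classes through the structure sheaf are `σ_{≥1}`-invisible -/

/-- **THEOREM Σ (structure-sheaf case, first form).** For a finite locally free `E`, `u : E → 𝒪_X` and
`B ∈ Ext²(𝒪_X, E)`, the class `x = u · B ∈ Ext²(E, E)` («`E → 𝒪 → E[2]`») has `σ_q(x) = 0` for every `q ≥ 1`:
by dinaturality (BF Cor. 4.8) `σ_q^{E}(u · B) = σ_q^{𝒪}(B · u) = 0`. Such classes are seen by the semiregularity
map only through the trace `σ_0`. [cite: BuchweitzFlenner2003, Cor. 4.8 (consequence)] -/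
theorem sigmaHigher_mk₀_comp_eq_zero_of_unitModule {E : X.left.Modules} (hE : IsFiniteLocallyFree E)
    (u : E ⟶ unitModule X.left) (B : Ext (unitModule X.left) E 2) (q : ℕ) (hq : 1 ≤ q) :
    sigmaHigher hE q ((Ext.mk₀ u).comp B (zero_add 2)) = 0 := by
  rw [sigmaHigher_dinatural hE isFiniteLocallyFree_unitModule u q B,
    sigmaHigher_unitModule_eq_zero _ q hq]

/-- **THEOREM Σ (structure-sheaf case, second form).** For `u′ : 𝒪_X → E` and `B′ ∈ Ext²(E, 𝒪_X)` the class
`x = B′ · u′ ∈ Ext²(E, E)` («`E → 𝒪[2] → E[2]`») has `σ_q(x) = 0` for every `q ≥ 1`.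
[cite: BuchweitzFlenner2003, Cor. 4.8 (consequence)] -/
theorem sigmaHigher_comp_mk₀_eq_zero_of_unitModule {E : X.left.Modules} (hE : IsFiniteLocallyFree E)
    (u' : unitModule X.left ⟶ E) (B' : Ext E (unitModule X.left) 2) (q : ℕ) (hq : 1 ≤ q) :
    sigmaHigher hE q (B'.comp (Ext.mk₀ u') (add_zero 2)) = 0 := by
  rw [← sigmaHigher_dinatural isFiniteLocallyFree_unitModule hE u' q B',
    sigmaHigher_unitModule_eq_zero _ q hq]

/-- **Corollary (no trace degree ⇒ no class through `𝒪`).** If `E` is `J`-semiregular for an index set `J` of form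
degrees with `0 ∉ J` (i.e. the Chern-degree set `I` of the seed predicates does not contain `1`), then every class
`u · B : E → 𝒪_X → E[2]` VANISHES in `Ext²(E, E)`. So an `I`-semiregular seed with `1 ∉ I` admits no non-zero
`Ext²`-class through the structure sheaf; with `0 ∈ J` such classes survive only through their `σ_0`-trace (pen:
rank `≤ h^{0,2}`). [cite: BuchweitzFlenner2003, §5 (I-semiregular) and Cor. 4.8] -/
theorem IsISemiregular.mk₀_comp_eq_zero_of_unitModule {E : X.left.Modules} {hE : IsFiniteLocallyFree E}
    {J : Set ℕ} (h : IsISemiregular hE J) (hJ : ∀ q ∈ J, 1 ≤ q) (u : E ⟶ unitModule X.left)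
    (B : Ext (unitModule X.left) E 2) :
    (Ext.mk₀ u).comp B (zero_add 2) = 0 :=
  h _ fun q hq => sigmaHigher_mk₀_comp_eq_zero_of_unitModule hE u B q (hJ q hq)

/-- The same for classes `B′ · u′ : E → 𝒪_X[2] → E[2]`. [cite: BuchweitzFlenner2003, §5 and Cor. 4.8] -/
theorem IsISemiregular.comp_mk₀_eq_zero_of_unitModule {E : X.left.Modules} {hE : IsFiniteLocallyFree E}
    {J : Set ℕ} (h : IsISemiregular hE J) (hJ : ∀ q ∈ J, 1 ≤ q) (u' : unitModule X.left ⟶ E)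
    (B' : Ext E (unitModule X.left) 2) :
    B'.comp (Ext.mk₀ u') (add_zero 2) = 0 :=
  h _ fun q hq => sigmaHigher_comp_mk₀_eq_zero_of_unitModule hE u' B' q (hJ q hq)

/-! ### §4 THEOREM Σ for trivial bundles `𝒪_X^{⊕m}` (finite biproducts of the structure sheaf) -/

/-- `Ext.mk₀` is additive over finite sums. [folklore] -/
theorem Ext_mk₀_sum {A B : X.left.Modules} {ι : Type*} (t : Finset ι) (f : ι → (A ⟶ B)) :
    Ext.mk₀ (∑ i ∈ t, f i) = ∑ i ∈ t, Ext.mk₀ (f i) :=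
  map_sum (AddMonoidHom.mk' (fun g : A ⟶ B => Ext.mk₀ g) Ext.mk₀_add) f t

/-- Precomposition in `Ext` is additive over finite sums. [folklore] -/
theorem Ext_sum_comp {A B C : X.left.Modules} {ι : Type*} (t : Finset ι) {n m p : ℕ} (α : ι → Ext A B n)
    (β : Ext B C m) (h : n + m = p) :
    (∑ i ∈ t, α i).comp β h = ∑ i ∈ t, (α i).comp β h :=
  map_sum (AddMonoidHom.mk' (fun a : Ext A B n => a.comp β h) fun a b => Ext.add_comp a b β h) α t

/-- **THEOREM Σ for a trivial bundle `F = ⨁_{j ∈ J} 𝒪_X`** (`J` finite): for `E` finite locally free, `u : E → F`,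
`B ∈ Ext²(F, E)` and every `q ≥ 1`, `σ_q(u · B) = 0` (finite biproducts exist in the abelian category `X.Modules`:
supply `HasFiniteBiproducts.of_hasFiniteProducts`) — decompose `𝟙_F = Σ_j π_j ι_j` (`biproduct.total`), so
`u · B = Σ_j (u π_j) · (ι_j B)` is a sum of classes through `𝒪_X`, each killed by `σ_q`
(`sigmaHigher_mk₀_comp_eq_zero_of_unitModule`). This is the shape of the (C2)∕D7 designs `E = ker(𝒪^{r₀} ⊕ V₊ ↠ T)`
with `u = pr : E → 𝒪^{r₀}`: ALL classes `pr · B`, `B ∈ Ext²(𝒪^{r₀}, E) = H²(E)^{r₀}`, are `σ_{≥1}`-invisible.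
[cite: BuchweitzFlenner2003, Cor. 4.8 (consequence)] -/
theorem sigmaHigher_mk₀_comp_eq_zero_of_biproduct_unitModule [HasFiniteBiproducts X.left.Modules]
    {E : X.left.Modules} (hE : IsFiniteLocallyFree E) {J : Type} [Fintype J]
    (u : E ⟶ biproduct fun _ : J => unitModule X.left)
    (B : Ext (biproduct fun _ : J => unitModule X.left) E 2) (q : ℕ) (hq : 1 ≤ q) :
    sigmaHigher hE q ((Ext.mk₀ u).comp B (zero_add 2)) = 0 := by
  classical
  have hu : u = ∑ j, (u ≫ biproduct.π (fun _ : J => unitModule X.left) j) ≫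
      biproduct.ι (fun _ : J => unitModule X.left) j := by
    simp only [Category.assoc, ← Preadditive.comp_sum, biproduct.total, Category.comp_id]
  rw [hu, Ext_mk₀_sum, Ext_sum_comp, map_sum]
  refine Finset.sum_eq_zero fun j _ => ?_
  rw [← Ext.mk₀_comp_mk₀_assoc]
  exact sigmaHigher_mk₀_comp_eq_zero_of_unitModule hE _ _ q hq

/-- **Corollary for `I`-semiregular sheaves with `1 ∉ I`** (no trace degree): no non-zero class
`E → 𝒪_X^{⊕m} → E[2]` in `Ext²(E, E)`. [cite: BuchweitzFlenner2003, §5 and Cor. 4.8] -/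
theorem IsISemiregular.mk₀_comp_eq_zero_of_biproduct_unitModule [HasFiniteBiproducts X.left.Modules]
    {E : X.left.Modules} {hE : IsFiniteLocallyFree E} {I : Set ℕ} (h : IsISemiregular hE I)
    (hI : ∀ q ∈ I, 1 ≤ q) {J : Type} [Fintype J] (u : E ⟶ biproduct fun _ : J => unitModule X.left)
    (B : Ext (biproduct fun _ : J => unitModule X.left) E 2) :
    (Ext.mk₀ u).comp B (zero_add 2) = 0 :=
  h _ fun q hq => sigmaHigher_mk₀_comp_eq_zero_of_biproduct_unitModule hE u B q (hI q hq)

/-! ### §5 The «injective modulo trace» form for an ARBITRARY index set (kernel form of (S2)) -/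

/-- **(S2) in kernel form, any `J`.** If `E` is `J`-semiregular for ANY set `J` of form degrees (trace degree allowed),
then a class `x = u · B : E → 𝒪_X → E[2]` is determined by its trace component: `σ_0(x) = 0 ⟹ x = 0`. (Pen corollary:
the map `B ↦ u·B` has rank `≤ h^{0,2}(X)` — the target of `σ_0` — for a semiregular `E`; the dimension count is not
expressible on these carriers.) [cite: BuchweitzFlenner2003, §5 and Cor. 4.8] -/
theorem IsISemiregular.mk₀_comp_eq_zero_of_sigmaHigher_zero_eq_zero {E : X.left.Modules}
    {hE : IsFiniteLocallyFree E} {J : Set ℕ} (h : IsISemiregular hE J) (u : E ⟶ unitModule X.left)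
    (B : Ext (unitModule X.left) E 2) (h0 : sigmaHigher hE 0 ((Ext.mk₀ u).comp B (zero_add 2)) = 0) :
    (Ext.mk₀ u).comp B (zero_add 2) = 0 := by
  refine h _ fun q _ => ?_
  rcases Nat.eq_zero_or_pos q with rfl | hq
  · exact h0
  · exact sigmaHigher_mk₀_comp_eq_zero_of_unitModule hE u B q hq

/-- The same for trivial bundles `⨁_{j ∈ J′} 𝒪_X` (the (C2)∕D7 shape `pr · B`, `B ∈ H²(E)^{r₀}`): for a semiregular `E`
(any index set), `pr · B` vanishes as soon as its trace `σ_0(pr · B) ∈ H²(X, 𝒪_X)` does.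
[cite: BuchweitzFlenner2003, §5 and Cor. 4.8] -/
theorem IsISemiregular.mk₀_comp_eq_zero_of_sigmaHigher_zero_eq_zero_biproduct [HasFiniteBiproducts X.left.Modules]
    {E : X.left.Modules} {hE : IsFiniteLocallyFree E} {I : Set ℕ} (h : IsISemiregular hE I) {J : Type} [Fintype J]
    (u : E ⟶ biproduct fun _ : J => unitModule X.left) (B : Ext (biproduct fun _ : J => unitModule X.left) E 2)
    (h0 : sigmaHigher hE 0 ((Ext.mk₀ u).comp B (zero_add 2)) = 0) :
    (Ext.mk₀ u).comp B (zero_add 2) = 0 := by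
  refine h _ fun q _ => ?_
  rcases Nat.eq_zero_or_pos q with rfl | hq
  · exact h0
  · exact sigmaHigher_mk₀_comp_eq_zero_of_biproduct_unitModule hE u B q hq

/-! ### §6 The MOMENT FILTER in kernel form: classes through a family of bundles `F_i` are σ-visible only through
their shadows `B_i · u_i ∈ Ext²(F_i, F_i)` (dinaturality, summed) -/

/-- **σ of a sum of factorised classes** (BF Cor. 4.8, summed): for finite locally free `E`, `F_i` (`i ∈ t`), maps
`u_i : E → F_i` and classes `B_i ∈ Ext²(F_i, E)`, `σ_q^{E}(Σ_i u_i · B_i) = Σ_i σ_q^{F_i}(B_i · u_i)` — the semiregularity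
vector of the sum is determined by the SHADOWS `B_i · u_i ∈ Ext²(F_i, F_i)` (for a line bundle `F_i = L_i`: a class in the
15-dimensional `Ext²(L_i, L_i) = H²(X, 𝒪_X)`, on which `σ_q^{L_i}` is cup with `at(L_i)^q` — pen). This is the kernel form of the MOMENT
FILTER (F-Σ′) of the crux workfile `DESIGN-WINDOW-FRAME-rung1-g2.md`. [cite: BuchweitzFlenner2003, Cor. 4.8 (consequence)] -/
theorem sigmaHigher_sum_mk₀_comp_eq_sum {E : X.left.Modules} (hE : IsFiniteLocallyFree E) {ι : Type*} (t : Finset ι)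
    (F : ι → X.left.Modules) (hF : ∀ i, IsFiniteLocallyFree (F i)) (u : ∀ i, E ⟶ F i) (B : ∀ i, Ext (F i) E 2) (q : ℕ) :
    sigmaHigher hE q (∑ i ∈ t, (Ext.mk₀ (u i)).comp (B i) (zero_add 2)) =
      ∑ i ∈ t, sigmaHigher (hF i) q ((B i).comp (Ext.mk₀ (u i)) (add_zero 2)) := by
  rw [map_sum]
  exact Finset.sum_congr rfl fun i _ => sigmaHigher_dinatural hE (hF i) (u i) q (B i)

/-- **The moment filter, kernel form.** If `E` is `J`-semiregular, then a sum of factorised classes `x = Σ_i u_i · B_i`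
whose shadows have vanishing semiregularity vector — `Σ_i σ_q^{F_i}(B_i · u_i) = 0` for every `q ∈ J` — is ZERO in
`Ext²(E, E)`. (For line bundles `L_i` with `at(L_i) = N_i·a` proportional this is the Vandermonde moment condition
`a^q ∪ Σ_i N_i^q η_i = 0`; with full trace images it leaves `≥ 15(r − |J|)` blind classes — pen count in the workfile.)
[cite: BuchweitzFlenner2003, §5 and Cor. 4.8] -/
theorem IsISemiregular.sum_mk₀_comp_eq_zero_of_shadows {E : X.left.Modules} {hE : IsFiniteLocallyFree E} {J : Set ℕ}
    (h : IsISemiregular hE J) {ι : Type*} (t : Finset ι) (F : ι → X.left.Modules) (hF : ∀ i, IsFiniteLocallyFree (F i))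
    (u : ∀ i, E ⟶ F i) (B : ∀ i, Ext (F i) E 2)
    (hshadow : ∀ q ∈ J, ∑ i ∈ t, sigmaHigher (hF i) q ((B i).comp (Ext.mk₀ (u i)) (add_zero 2)) = 0) :
    ∑ i ∈ t, (Ext.mk₀ (u i)).comp (B i) (zero_add 2) = 0 :=
  h _ fun q hq => (sigmaHigher_sum_mk₀_comp_eq_sum hE t F hF u B q).trans (hshadow q hq)

/-! ### §7 THEOREM Σ for ATIYAH-FLAT carriers `F` (`At(F) = 0`): flat ∕ unipotent ∕ `Pic⁰`-type pieces are `σ_{≥1}`-invisible too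

(rung-1 g3, CENSUS-3 §6: the surviving designs decorate their start summands and pieces by `Pic⁰` classes and use
translation-invariant ∕ homogeneous bundles; every such `F` has `At(F) = 0` — Atiyah 1957: `At(F) = 0` iff `F` admits a
holomorphic connection. §1–§3 are the case `F = 𝒪_X`; here the only input is the HYPOTHESIS `atiyahClass F = 0`.) -/

/-- `ι · at₀(F) = At(F) · e₁⁻¹ = 0` for an Atiyah-flat `F` (tree `atiyahClass_comp_hodgeSheafOneIso_inv`).
[cite: BuchweitzFlenner2003, §3] [cite: Atiyah1957, §2 Thm. 2] -/
theorem toTwistHodgeZero_comp_atiyahClassStep_of_atiyahClass_eq_zero (F : X.left.Modules)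
    (hAt : atiyahClass F = 0) :
    (Ext.mk₀ (toTwistHodgeZero F)).comp (atiyahClassStep F 0) (zero_add 1) = 0 := by
  rw [← atiyahClass_comp_hodgeSheafOneIso_inv F, hAt]
  simp only [Ext.zero_comp]

/-- For an Atiyah-flat `F`, `q ≥ 1` and any `z ∈ Ext²(G, F)`: `(z · ι) · At(F)^q = 0` (`At^q = at₀ · at₁ ⋯`, `ι · at₀ = 0`).
[cite: BuchweitzFlenner2003, §4 (At^k)] -/
theorem comp_toTwistHodgeZero_comp_atiyahClassPower_of_atiyahClass_eq_zero {G F : X.left.Modules}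
    (hAt : atiyahClass F = 0) (z : Ext G F 2) (q : ℕ) (hq : 1 ≤ q) :
    (z.comp (Ext.mk₀ (toTwistHodgeZero F)) (add_zero 2)).comp (atiyahClassPower F q) (add_comm 2 q) = 0 := by
  induction q with
  | zero => exact absurd hq (by norm_num)
  | succ q ih =>
    rcases Nat.eq_zero_or_pos q with hq0 | hqpos
    · subst hq0
      rw [atiyahClassPower_succ F, atiyahClassPower_zero F, Ext.mk₀_id_comp]
      rw [Ext.comp_assoc_of_second_deg_zero, toTwistHodgeZero_comp_atiyahClassStep_of_atiyahClass_eq_zero F hAt]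
      simp only [Ext.comp_zero]
    · rw [atiyahClassPower_succ F, ← Ext.comp_assoc _ _ _ (add_comm 2 q) rfl (by lia), ih hqpos]
      simp only [Ext.zero_comp]

/-- **`σ_q^{F} = 0` for `q ≥ 1` when `At(F) = 0`**: an Atiyah-flat finite locally free `F` has all higher semiregularity
components zero — so it is `J`-semiregular for an index set `J ∌ 0` only if `Ext²(F, F) = 0` (next lemma).
[cite: BuchweitzFlenner2003, Def. 4.1] [cite: Atiyah1957, §2 Thm. 2] -/
theorem sigmaHigher_eq_zero_of_atiyahClass_eq_zero {F : X.left.Modules} (hF : IsFiniteLocallyFree F)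
    (hAt : atiyahClass F = 0) (q : ℕ) (hq : 1 ≤ q) (z : Ext F F 2) :
    sigmaHigher hF q z = 0 := by
  rw [sigmaHigher_apply, comp_toTwistHodgeZero_comp_atiyahClassPower_of_atiyahClass_eq_zero hAt z q hq]
  exact map_zero _

/-- **An Atiyah-flat `F` with a non-zero `Ext²(F, F)` is `J`-semiregular for NO `J` avoiding the trace degree `0`**
(e.g. a flat line bundle on an abelian variety of dimension `≥ 2`, `Ext² = H²(𝒪) ≠ 0`, is `{2}`-semiregular — the door
`I = {3}` — for no reason other than the trace). [cite: BuchweitzFlenner2003, §5 (I-semiregular)] -/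
theorem IsISemiregular.eq_zero_of_atiyahClass_eq_zero {F : X.left.Modules} {hF : IsFiniteLocallyFree F} {J : Set ℕ}
    (h : IsISemiregular hF J) (hJ : ∀ q ∈ J, 1 ≤ q) (hAt : atiyahClass F = 0) (z : Ext F F 2) : z = 0 :=
  h z fun q hq => sigmaHigher_eq_zero_of_atiyahClass_eq_zero hF hAt q (hJ q hq) z

/-- **THEOREM Σ for an Atiyah-flat carrier (first form).** For `E`, `F` finite locally free with `At(F) = 0`, `u : E → F`
and `B ∈ Ext²(F, E)`: `σ_q^{E}(u · B) = σ_q^{F}(B · u) = 0` for every `q ≥ 1` (dinaturality, BF Cor. 4.8). Classes of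
`Ext²(E, E)` through a flat ∕ `Pic⁰`-type ∕ unipotent piece are seen only by the trace `σ_0`.
[cite: BuchweitzFlenner2003, Cor. 4.8 (consequence)] [cite: Atiyah1957, §2 Thm. 2] -/
theorem sigmaHigher_mk₀_comp_eq_zero_of_atiyahClass_eq_zero {E F : X.left.Modules} (hE : IsFiniteLocallyFree E)
    (hF : IsFiniteLocallyFree F) (hAt : atiyahClass F = 0) (u : E ⟶ F) (B : Ext F E 2) (q : ℕ) (hq : 1 ≤ q) :
    sigmaHigher hE q ((Ext.mk₀ u).comp B (zero_add 2)) = 0 := by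
  rw [sigmaHigher_dinatural hE hF u q B, sigmaHigher_eq_zero_of_atiyahClass_eq_zero hF hAt q hq]

/-- **THEOREM Σ for an Atiyah-flat carrier (second form)**: `σ_q^{E}(B′ · u′) = 0` for `u′ : F → E`, `B′ ∈ Ext²(E, F)`,
`q ≥ 1`. [cite: BuchweitzFlenner2003, Cor. 4.8 (consequence)] -/
theorem sigmaHigher_comp_mk₀_eq_zero_of_atiyahClass_eq_zero {E F : X.left.Modules} (hE : IsFiniteLocallyFree E)
    (hF : IsFiniteLocallyFree F) (hAt : atiyahClass F = 0) (u' : F ⟶ E) (B' : Ext E F 2) (q : ℕ) (hq : 1 ≤ q) :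
    sigmaHigher hE q (B'.comp (Ext.mk₀ u') (add_zero 2)) = 0 := by
  rw [← sigmaHigher_dinatural hF hE u' q B', sigmaHigher_eq_zero_of_atiyahClass_eq_zero hF hAt q hq]

/-- **Corollary (no trace degree ⇒ no class through an Atiyah-flat piece).** If `E` is `J`-semiregular with `0 ∉ J`
(Chern-degree set `I ∌ 1`), every class `u · B : E → F → E[2]` with `At(F) = 0` vanishes in `Ext²(E, E)`.
[cite: BuchweitzFlenner2003, §5 and Cor. 4.8] -/
theorem IsISemiregular.mk₀_comp_eq_zero_of_atiyahClass_eq_zero {E F : X.left.Modules} {hE : IsFiniteLocallyFree E}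
    {J : Set ℕ} (h : IsISemiregular hE J) (hJ : ∀ q ∈ J, 1 ≤ q) (hF : IsFiniteLocallyFree F)
    (hAt : atiyahClass F = 0) (u : E ⟶ F) (B : Ext F E 2) :
    (Ext.mk₀ u).comp B (zero_add 2) = 0 :=
  h _ fun q hq => sigmaHigher_mk₀_comp_eq_zero_of_atiyahClass_eq_zero hE hF hAt u B q (hJ q hq)

/-- With the trace degree present (`0 ∈ J` allowed): a class through an Atiyah-flat `F` whose `σ_0`-shadow vanishes is
itself zero — the kernel form of «rank `Φ_u` ≤ `h^{0,2}`» ((S2)∕(S5) of the workfile) for flat pieces.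
[cite: BuchweitzFlenner2003, §5 and Cor. 4.8] -/
theorem IsISemiregular.mk₀_comp_eq_zero_of_atiyahClass_eq_zero_of_sigmaHigher_zero {E F : X.left.Modules}
    {hE : IsFiniteLocallyFree E} {J : Set ℕ} (h : IsISemiregular hE J) (hF : IsFiniteLocallyFree F)
    (hAt : atiyahClass F = 0) (u : E ⟶ F) (B : Ext F E 2)
    (h0 : sigmaHigher hE 0 ((Ext.mk₀ u).comp B (zero_add 2)) = 0) :
    (Ext.mk₀ u).comp B (zero_add 2) = 0 := by
  refine h _ fun q _ => ?_
  rcases Nat.eq_zero_or_pos q with rfl | hq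
  · exact h0
  · exact sigmaHigher_mk₀_comp_eq_zero_of_atiyahClass_eq_zero hE hF hAt u B q hq

end Summit.HodgeConjecture.HodgeConjecture.Theorems

end
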